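import Literature.MathematicalPhysics.QuantumFieldTheory.Balaban1983to89.Node00.WilsonActionSecondVariation

/-!
# NODE 00 — THE SECOND VARIATION OF THE WILSON ACTION (5) ALONG AN ARBITRARY `C²` CURVE OF `SU(N)` CONFIGURATIONS (chart-free):
# `d²∕dt² A(γ_t)∣_{t₀} = −(1∕N)·Σ_p Re Tr( Σ_k [acceleration W inserted at edge k] + 2·Σ_{k<l} [velocities V inserted at edges k, l] )` — Hessian plus first variation of the
# acceleration, the form a composite `γ = (minimiser) ∘ (coarse perturbation)` is read through ([B16] (1.12): at a critical configuration only `H*Δ₁H` survives)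

Cell `pub-ymgap`, WIDTH SEAT `pub-ymgap-dag-n12-w2` generation 0 (HUMAN RULING D-0149 ∕ director-ym №197; DAG node N12 = [B15]; W-SEAT-START-LIST v2 §N12 ITEM 2 = U2a,
third file; INBOX INTENT-3).  CONSUMED BY NAME: n07-e g8 `Node00.WilsonActionFirstVariation` (`hasDerivAt_coe_plaqHol`, `hasDerivAt_wilsonAction4` — the first variation along a
curve at EVERY parameter where bond-wise velocities exist), this seat's p583639 `Node00.WilsonActionSecondVariation` (`hasDerivAt_re_trace`; and, for the cross-check, the ray
`hasDerivAt_coe_expChart_smul`).  `--kind proof --supports stmt-QuantumFields-20542` (K1⁷; count-neutral).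

PRINT.  [B9] = [Balaban1985BackgroundPropagators] p. 390 (3.1)–(3.2): the plaquette variable of `U′U₀` expanded to second order, «−½η²[Σ_b (A′(b))² + 2Σ_{b₁≺b₂}A′(b₁)A′(b₂)]»;
p. 391 (3.7) «A^η(U′U₀) = A^η(U₀) + ⟨D A, η⁻²Im ∂U₀⟩ + ½⟨A, Δ^η(U₀)A⟩ + ⋯».  [B16] = [Balaban1989LargeFieldII] p. 359: «we consider the variational problem for the function
V′↾_Λ → A(U_{k,Z}(V′Ṽ_k)) … We expand the function with respect to B′ … ⟨δB′, H_{1,k}J_{k,Z}⟩ + ⟨δB′, H_{1,k}Δ₁H_{1,k}B′⟩ + ⟨δB′, H_{1,k}(δ∕δA)V(H_{1,k}B′)⟩ = 0 (1.12)» — the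
action composed with a CURVE of configurations (the minimisers of the perturbed data), whose second derivative is the Hessian on the velocity plus the first variation on the
acceleration; [15] = [Balaban1985Variational] (5) p. 278, Sect. F p. 300 (criticality kills the second summand on admissible accelerations).

CONTENTS (theorems only; no `def`, no `instance`).  For a curve `γ : ℝ → GaugeField P j (SU N)` with bond-wise matrix velocities `V t b` at every `t` near `t₀` and bond-wise
accelerations `W b` at `t₀` (`HasDerivAt (V · b) (W b) t₀`); letters at `t₀`: `A = ↑γ⟨x,μ⟩, B = ↑γ⟨x+e_μ,ν⟩, C = ↑γ⟨x+e_ν,μ⟩, D = ↑γ⟨x,ν⟩`, `V_k`, `W_k` at the same four bonds.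
* §1 ★ `hasDerivAt_fourTerm` — the derivative at `t₀` of g8's four-term first-variation integrand `V₁BC⋆D⋆ + AV₂C⋆D⋆ + AB V₃⋆D⋆ + ABC⋆V₄⋆` along `(γ, V)`:
  `Σ_k [W_k inserted] + 2·Σ_{k<l} [V_k, V_l inserted]` (sixteen Leibniz terms, the six ordered pairs twice).
* §2 ★★★ `hasDerivAt_deriv_wilsonAction4_along` — `HasDerivAt (deriv (A ∘ γ)) (−(1∕N)Σ_p Re Tr(…)) t₀`: THE SECOND VARIATION ALONG THE CURVE (g8 at every nearby `t` gives
  `deriv (A∘γ)` as the four-term sum; §1 differentiates it).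
* (not re-landed) on the ray `γ t = U·e^{tX}` (`V t b = 𝕌_b e^{t𝕏_b}𝕏_b`, `W b = 𝕌_b𝕏_b²`) §2 reproduces VERBATIM the (3.2) inserted shape of the sequel
  `Node00.WilsonActionSecondVariationExpansion.hasDerivAt_deriv_wilsonAction4_expChart_inserted` (checked in session; the gate's dedup keeps one copy) — two independent derivations agree.

HONEST FRAMING: calculus about the tree's own action functional (product rule, trace); nothing of Bałaban's estimates; dischargeability-neutral for N12's (L2) `hlead` until U2b∕U2c;
count-neutral; N12 NOT discharged (5∕27 unmoved); finite 𝕋⁴ at fixed ε, Bałaban AS PRINTED with locators; R4 closes the conditional rung `BalabanLadder.UV` only — NOT continuum ∕ ℝ⁴ ∕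
OS ∕ mass gap ∕ Clay.  No `sorry`, no `def`, no `instance`.
-/

noncomputable section

namespace Literature.MathematicalPhysics.QuantumFieldTheory.Balaban1983to89.Node00

open Filter Topology
open T4AdjointCovarianceUnitary (lieSU)
open scoped Matrix.Norms.L2Operator

/-! ## §1  The derivative of the four-term first-variation integrand along `(γ, V)` -/

section FourTerm

variable {N : ℕ}

/-- ★ **SIXTEEN LEIBNIZ TERMS, REGROUPED**: along matrix curves `A, B, C, D` (values at `t₀`: `A₀, …`) with derivatives `V₁, …, V₄` at `t₀`, and velocity curves `V₁(·), …, V₄(·)`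
(values `V₁, …` at `t₀`) with derivatives `W₁, …, W₄` at `t₀`, the four-term sum `V₁(t)B(t)C(t)⋆D(t)⋆ + A(t)V₂(t)C(t)⋆D(t)⋆ + A(t)B(t)V₃(t)⋆D(t)⋆ + A(t)B(t)C(t)⋆V₄(t)⋆` has derivative
`W₁B₀C₀⋆D₀⋆ + A₀W₂C₀⋆D₀⋆ + A₀B₀W₃⋆D₀⋆ + A₀B₀C₀⋆W₄⋆ + 2·(V₁V₂C₀⋆D₀⋆ + V₁B₀V₃⋆D₀⋆ + V₁B₀C₀⋆V₄⋆ + A₀V₂V₃⋆D₀⋆ + A₀V₂C₀⋆V₄⋆ + A₀B₀V₃⋆V₄⋆)` at `t₀` — «Σ_b(A′(b))² + 2Σ_{b₁≺b₂}A′(b₁)A′(b₂)»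
with accelerations in place of squares. [cite: Balaban1985BackgroundPropagators, (3.2) p.390; Balaban1985Variational, (5) p.278] -/
theorem hasDerivAt_fourTerm {A B C D V₁ V₂ V₃ V₄ : ℝ → Matrix (Fin N) (Fin N) ℂ} {W₁ W₂ W₃ W₄ : Matrix (Fin N) (Fin N) ℂ} {t₀ : ℝ}
    (hA : HasDerivAt A (V₁ t₀) t₀) (hB : HasDerivAt B (V₂ t₀) t₀) (hC : HasDerivAt C (V₃ t₀) t₀) (hD : HasDerivAt D (V₄ t₀) t₀)
    (h₁ : HasDerivAt V₁ W₁ t₀) (h₂ : HasDerivAt V₂ W₂ t₀) (h₃ : HasDerivAt V₃ W₃ t₀) (h₄ : HasDerivAt V₄ W₄ t₀) :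
    HasDerivAt (fun t => V₁ t * B t * star (C t) * star (D t) + A t * V₂ t * star (C t) * star (D t)
        + A t * B t * star (V₃ t) * star (D t) + A t * B t * star (C t) * star (V₄ t))
      (W₁ * B t₀ * star (C t₀) * star (D t₀) + A t₀ * W₂ * star (C t₀) * star (D t₀)
        + A t₀ * B t₀ * star W₃ * star (D t₀) + A t₀ * B t₀ * star (C t₀) * star W₄
        + 2 • (V₁ t₀ * V₂ t₀ * star (C t₀) * star (D t₀) + V₁ t₀ * B t₀ * star (V₃ t₀) * star (D t₀)
          + V₁ t₀ * B t₀ * star (C t₀) * star (V₄ t₀) + A t₀ * V₂ t₀ * star (V₃ t₀) * star (D t₀)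
          + A t₀ * V₂ t₀ * star (C t₀) * star (V₄ t₀) + A t₀ * B t₀ * star (V₃ t₀) * star (V₄ t₀))) t₀ := by
  have e1 := ((h₁.mul hB).mul hC.star).mul hD.star
  have e2 := ((hA.mul h₂).mul hC.star).mul hD.star
  have e3 := ((hA.mul hB).mul h₃.star).mul hD.star
  have e4 := ((hA.mul hB).mul hC.star).mul h₄.star
  refine (((e1.add e2).add e3).add e4).congr_deriv ?_
  simp only [Pi.mul_apply, two_smul]
  noncomm_ring

end FourTerm

/-! ## §2  The second variation along the curve -/

section Along

variable {P : Params} {j : ℕ} {N : ℕ} [NeZero N]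

/-- ★★★ **THE SECOND VARIATION OF THE WILSON ACTION ALONG A `C²` CURVE OF CONFIGURATIONS** (chart-free).  Let `γ : ℝ → GaugeField P j (SU N)` have bond-wise matrix
velocities `V t b` at every `t` near `t₀` and let the velocities have derivatives `W b` at `t₀`.  Then `t ↦ A(γ_t)` is twice differentiable at `t₀` and
`d²∕dt² A(γ_t)∣_{t₀} = −(1∕N)·Σ_p Re Tr( W₁BC⋆D⋆ + AW₂C⋆D⋆ + ABW₃⋆D⋆ + ABC⋆W₄⋆ + 2·[V₁V₂C⋆D⋆ + V₁BV₃⋆D⋆ + V₁BC⋆V₄⋆ + AV₂V₃⋆D⋆ + AV₂C⋆V₄⋆ + ABV₃⋆V₄⋆] )` — the HESSIAN of (5)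
on the velocity (the pair terms, (3.2)∕(3.7)) PLUS THE FIRST VARIATION ON THE ACCELERATION (the `W` terms = g8's four-term sum at `W`; it vanishes on admissible accelerations at
a critical configuration, [15] Sect. F — whence only `⟨δB′, H_{1,k}Δ₁H_{1,k}B′⟩` at second order in [B16] (1.12)).
[cite: Balaban1985BackgroundPropagators, (3.2) p.390, (3.7) p.391; Balaban1985Variational, (5) p.278, p.300; Balaban1989LargeFieldII, (1.12) p.359] -/
theorem hasDerivAt_deriv_wilsonAction4_along {γ : ℝ → GaugeField P j (SU N)} {V : ℝ → PBond P j → Matrix (Fin N) (Fin N) ℂ}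
    {W : PBond P j → Matrix (Fin N) (Fin N) ℂ} {t₀ : ℝ}
    (hγ : ∀ᶠ t in 𝓝 t₀, ∀ b, HasDerivAt (fun s => ((γ s b : SU N) : Matrix (Fin N) (Fin N) ℂ)) (V t b) t)
    (hV : ∀ b, HasDerivAt (fun s => V s b) (W b) t₀) :
    HasDerivAt (deriv fun s => wilsonAction4 (γ s))
      (-(∑ p : Plaq P j, (Matrix.trace
        (W ⟨p.src, p.μ⟩ * (γ t₀ ⟨p.src.shift p.μ, p.ν⟩ : Matrix (Fin N) (Fin N) ℂ) * star (γ t₀ ⟨p.src.shift p.ν, p.μ⟩ : Matrix (Fin N) (Fin N) ℂ)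
            * star (γ t₀ ⟨p.src, p.ν⟩ : Matrix (Fin N) (Fin N) ℂ)
          + (γ t₀ ⟨p.src, p.μ⟩ : Matrix (Fin N) (Fin N) ℂ) * W ⟨p.src.shift p.μ, p.ν⟩ * star (γ t₀ ⟨p.src.shift p.ν, p.μ⟩ : Matrix (Fin N) (Fin N) ℂ)
            * star (γ t₀ ⟨p.src, p.ν⟩ : Matrix (Fin N) (Fin N) ℂ)
          + (γ t₀ ⟨p.src, p.μ⟩ : Matrix (Fin N) (Fin N) ℂ) * (γ t₀ ⟨p.src.shift p.μ, p.ν⟩ : Matrix (Fin N) (Fin N) ℂ) * star (W ⟨p.src.shift p.ν, p.μ⟩)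
            * star (γ t₀ ⟨p.src, p.ν⟩ : Matrix (Fin N) (Fin N) ℂ)
          + (γ t₀ ⟨p.src, p.μ⟩ : Matrix (Fin N) (Fin N) ℂ) * (γ t₀ ⟨p.src.shift p.μ, p.ν⟩ : Matrix (Fin N) (Fin N) ℂ)
            * star (γ t₀ ⟨p.src.shift p.ν, p.μ⟩ : Matrix (Fin N) (Fin N) ℂ) * star (W ⟨p.src, p.ν⟩)
          + 2 • (V t₀ ⟨p.src, p.μ⟩ * V t₀ ⟨p.src.shift p.μ, p.ν⟩ * star (γ t₀ ⟨p.src.shift p.ν, p.μ⟩ : Matrix (Fin N) (Fin N) ℂ) * star (γ t₀ ⟨p.src, p.ν⟩ : Matrix (Fin N) (Fin N) ℂ)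
            + V t₀ ⟨p.src, p.μ⟩ * (γ t₀ ⟨p.src.shift p.μ, p.ν⟩ : Matrix (Fin N) (Fin N) ℂ) * star (V t₀ ⟨p.src.shift p.ν, p.μ⟩) * star (γ t₀ ⟨p.src, p.ν⟩ : Matrix (Fin N) (Fin N) ℂ)
            + V t₀ ⟨p.src, p.μ⟩ * (γ t₀ ⟨p.src.shift p.μ, p.ν⟩ : Matrix (Fin N) (Fin N) ℂ) * star (γ t₀ ⟨p.src.shift p.ν, p.μ⟩ : Matrix (Fin N) (Fin N) ℂ) * star (V t₀ ⟨p.src, p.ν⟩)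
            + (γ t₀ ⟨p.src, p.μ⟩ : Matrix (Fin N) (Fin N) ℂ) * V t₀ ⟨p.src.shift p.μ, p.ν⟩ * star (V t₀ ⟨p.src.shift p.ν, p.μ⟩) * star (γ t₀ ⟨p.src, p.ν⟩ : Matrix (Fin N) (Fin N) ℂ)
            + (γ t₀ ⟨p.src, p.μ⟩ : Matrix (Fin N) (Fin N) ℂ) * V t₀ ⟨p.src.shift p.μ, p.ν⟩ * star (γ t₀ ⟨p.src.shift p.ν, p.μ⟩ : Matrix (Fin N) (Fin N) ℂ) * star (V t₀ ⟨p.src, p.ν⟩)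
            + (γ t₀ ⟨p.src, p.μ⟩ : Matrix (Fin N) (Fin N) ℂ) * (γ t₀ ⟨p.src.shift p.μ, p.ν⟩ : Matrix (Fin N) (Fin N) ℂ) * star (V t₀ ⟨p.src.shift p.ν, p.μ⟩) * star (V t₀ ⟨p.src, p.ν⟩)))).re)
        / (Fintype.card (Fin N) : ℝ)) t₀ := by
  -- (i) near `t₀`, `deriv (A ∘ γ)` IS g8's four-term sum at the velocities `V t`
  have hderiv : (deriv fun s => wilsonAction4 (γ s)) =ᶠ[𝓝 t₀] fun t => ∑ p : Plaq P j,
      -(((Matrix.traceLinearMap (Fin N) ℝ ℂ)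
        (V t ⟨p.src, p.μ⟩ * (γ t ⟨p.src.shift p.μ, p.ν⟩ : Matrix (Fin N) (Fin N) ℂ) * star (γ t ⟨p.src.shift p.ν, p.μ⟩ : Matrix (Fin N) (Fin N) ℂ)
            * star (γ t ⟨p.src, p.ν⟩ : Matrix (Fin N) (Fin N) ℂ)
          + (γ t ⟨p.src, p.μ⟩ : Matrix (Fin N) (Fin N) ℂ) * V t ⟨p.src.shift p.μ, p.ν⟩ * star (γ t ⟨p.src.shift p.ν, p.μ⟩ : Matrix (Fin N) (Fin N) ℂ)
            * star (γ t ⟨p.src, p.ν⟩ : Matrix (Fin N) (Fin N) ℂ)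
          + (γ t ⟨p.src, p.μ⟩ : Matrix (Fin N) (Fin N) ℂ) * (γ t ⟨p.src.shift p.μ, p.ν⟩ : Matrix (Fin N) (Fin N) ℂ) * star (V t ⟨p.src.shift p.ν, p.μ⟩)
            * star (γ t ⟨p.src, p.ν⟩ : Matrix (Fin N) (Fin N) ℂ)
          + (γ t ⟨p.src, p.μ⟩ : Matrix (Fin N) (Fin N) ℂ) * (γ t ⟨p.src.shift p.μ, p.ν⟩ : Matrix (Fin N) (Fin N) ℂ)
            * star (γ t ⟨p.src.shift p.ν, p.μ⟩ : Matrix (Fin N) (Fin N) ℂ) * star (V t ⟨p.src, p.ν⟩))).re / (Fintype.card (Fin N) : ℝ)) :=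
    hγ.mono fun t ht => (hasDerivAt_wilsonAction4 ht fun p => hasDerivAt_coe_plaqHol ht p).deriv
  -- (ii) differentiate the four-term sums at `t₀`
  have h0 : ∀ b, HasDerivAt (fun s => ((γ s b : SU N) : Matrix (Fin N) (Fin N) ℂ)) (V t₀ b) t₀ := hγ.self_of_nhds
  have hp : ∀ p : Plaq P j, HasDerivAt (fun t => -(((Matrix.traceLinearMap (Fin N) ℝ ℂ)
        (V t ⟨p.src, p.μ⟩ * (γ t ⟨p.src.shift p.μ, p.ν⟩ : Matrix (Fin N) (Fin N) ℂ) * star (γ t ⟨p.src.shift p.ν, p.μ⟩ : Matrix (Fin N) (Fin N) ℂ)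
            * star (γ t ⟨p.src, p.ν⟩ : Matrix (Fin N) (Fin N) ℂ)
          + (γ t ⟨p.src, p.μ⟩ : Matrix (Fin N) (Fin N) ℂ) * V t ⟨p.src.shift p.μ, p.ν⟩ * star (γ t ⟨p.src.shift p.ν, p.μ⟩ : Matrix (Fin N) (Fin N) ℂ)
            * star (γ t ⟨p.src, p.ν⟩ : Matrix (Fin N) (Fin N) ℂ)
          + (γ t ⟨p.src, p.μ⟩ : Matrix (Fin N) (Fin N) ℂ) * (γ t ⟨p.src.shift p.μ, p.ν⟩ : Matrix (Fin N) (Fin N) ℂ) * star (V t ⟨p.src.shift p.ν, p.μ⟩)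
            * star (γ t ⟨p.src, p.ν⟩ : Matrix (Fin N) (Fin N) ℂ)
          + (γ t ⟨p.src, p.μ⟩ : Matrix (Fin N) (Fin N) ℂ) * (γ t ⟨p.src.shift p.μ, p.ν⟩ : Matrix (Fin N) (Fin N) ℂ)
            * star (γ t ⟨p.src.shift p.ν, p.μ⟩ : Matrix (Fin N) (Fin N) ℂ) * star (V t ⟨p.src, p.ν⟩))).re / (Fintype.card (Fin N) : ℝ))) _ t₀ :=
    fun p => ((hasDerivAt_re_trace (hasDerivAt_fourTerm (h0 ⟨p.src, p.μ⟩) (h0 ⟨p.src.shift p.μ, p.ν⟩) (h0 ⟨p.src.shift p.ν, p.μ⟩) (h0 ⟨p.src, p.ν⟩)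
      (hV ⟨p.src, p.μ⟩) (hV ⟨p.src.shift p.μ, p.ν⟩) (hV ⟨p.src.shift p.ν, p.μ⟩) (hV ⟨p.src, p.ν⟩))).div_const (Fintype.card (Fin N) : ℝ)).neg
  refine ((HasDerivAt.fun_sum fun p _ => hp p).congr_of_eventuallyEq hderiv).congr_deriv ?_
  rw [Finset.sum_neg_distrib, neg_div, Finset.sum_div]

end Along


end Literature.MathematicalPhysics.QuantumFieldTheory.Balaban1983to89.Node00

end
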